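import Summits.BirchSwinnertonDyer.BirchSwinnertonDyer.Theorems.TwoAdicConverseMultWalls
import Literature.NumberTheory.EllipticCurves.Spiess2014.WeakExceptionalZero
import HarnessLib

/-!
# Route `TwoAdicConverse` (rung S3), multiplicative branch, SPLIT sign: the rank-`0` 2-converse doors
# re-keyed from the MEMO binder «Greenberg–Stevens at a split `2`» to the PRINTED weak exceptional-zero
# vanishing (Spieß 2014 Thm. 5.7, `F = ℚ`) — items stmt-BirchSwinnertonDyer-19219 / 19187 (helper)

Cell `bsd-2adic`, seat `bsd-2adic-mult-gs-c` (literature-prover; PROGRAMME v1 T5 road C, 2026-08-26).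
THEOREMS ONLY — nothing asserted, no definition, no named fact, no class booked; BSD is not proved by any of
this. PARTITION (D-0054): none — RANK axis (S3 mult, split sign); companion formula cell X5@2 mult (K4ᵐ, B1·O1)
is NOT served (see below).

WHAT THIS FILE DOES. The split halves of the rank-`0` 2-converse doors of the cell
(`analyticRank_eq_zero_of_finite_selmer_split_two_of_multEisenstein`, GEN 0, and the WALL chain of
`Theorems/TwoAdicConverseMultWalls.lean`, GEN 5: `MultWalls.splitMultRankZeroTwoConverse_of_wallS3`,
`….multiplicativeRankZeroTwoConverse_of_wallsS3`, `….multTwoConverseOverKAtTwo_of_wallsS3`) carry the MEMO binder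
`hGS : ∀ W, W split multiplicative at 2 → greenberg_stevens W 2` (the Mazur–Tate–Teitelbaum / Greenberg–Stevens
identity `[T¹]L₂ · log₂ γ = 𝓛₂(E) · [0]⁺_f`; printed proofs keep `p` odd — PAdicBSD.lean "Generality flag"; the
cell's own `p = 2` argument is the memo PROOF-GS2). Reading the GEN-0 proof shows that `hGS` is used ONLY in its
last step, as «`[T¹]L₂ ≠ 0 ⇒ [0]⁺_f ≠ 0`», i.e. as the contrapositive of the WEAK exceptional-zero vanishing
«`L(E,1) = 0 ⇒ L₂'(E,1) = 0`». That vanishing is PRINTED with no parity hypothesis on `p`: Spieß, Invent. Math.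
196 (2014) Thm. 5.7 (`L_p^{(r)}(0,π) = r!∏𝓛_𝔭(π)∏e(α_𝔭,1)L(½,π)` with the AUTOMORPHIC `𝓛`-invariant; `F = ℚ`,
`r = 1`: `L_p'(0,π_E) = 𝓛_p(π_E)·L(E,1)`, so `L(E,1) = 0 ⇒ L_p'(E,1) = 0` whatever `𝓛_p(π_E)` is; for `F = ℚ`
"due to Darmon", Rem. 5.11 (a)), transcribed in the tree's currency as the cite-tagged named fact
`Literature.NumberTheory.EllipticCurves.Spiess2014.thm57_weakExceptionalZero_splitMultiplicative_rat W p`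
(`[0]⁺_f = 0 → [T¹]L = 0` for every `L` with `IsSplitMultPAdicLFunctionOf f p L`; p456266). This file
re-proves the split doors with that PRINT binder `hW` in place of `hGS`:

* §1 `analyticRank_eq_zero_of_finite_selmer_split_two_of_multEisenstein_of_weakEZ` — per curve: PRINT {A236
  `h41`, modularity `hmod`, Mahler–Manin (inside), `hW` = Spieß Thm. 5.7 at `(W, 2)`} + «`X` torsion» `hX` +
  T-mult-4-int `hEis` ⟹ (`Sel_{2^∞}(E/ℚ)` finite ⇒ `L(E,1) ≠ 0 ∧ r_an(E) = 0`). The proof is GEN 0's, verbatim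
  up to the last step (credited there), where `hW` replaces `hGS`.
* §2 the WALL chain with `hW`: `splitMultRankZeroTwoConverse_of_wallS3_of_weakEZ`,
  `multiplicativeRankZeroTwoConverse_of_wallsS3_of_weakEZ` (item 19219 from the two S3ᵐ walls + PRINT only — NO
  memo binder left), `multTwoConverseOverKAtTwo_of_wallsS3_of_weakEZ` (the served crux 19187 likewise).
* §3 bookkeeping: the old binder implies the new one (`weakEZ_two_of_greenbergStevens_two`, from the Literature
  lemma `…_of_greenberg_stevens`), so every existing composition re-keys in one line and nothing is lost.

CONSEQUENCE (for the planner / LINE `cycint` v2): on the S3 side the stub `stub_gs2` (MEMO) can be replaced by the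
PRINT stub `∀ W, split at 2 → Spiess2014.thm57_weakExceptionalZero_splitMultiplicative_rat W 2`; the research
content of the split half of 19219 is then the wall `stub_eisSplitFinSel` ALONE (plus PRINT). NOT affected: the
K4ᵐ formula doors at a split `2` (`X5/TwoAdicTargetsSplitGS.lean`: `kappaOne_of_greenbergStevens`, the
`κ₁`-valuation `ord₂[T¹]L = ord₂[0]⁺_f + ord₂𝓛₂(E) − 2`), which need the STRONG identity with `𝓛₂(E)`; no
claim that `𝓛_2(π_E) = 𝓛_2(E)` (in print only for `p ≥ 5`). The referee desk (D-audit) rules on the PRINT word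
for the Spieß fact; this file only shows what it buys.

Sources read (held): Spieß, arXiv:1207.2289 = Invent. Math. 196 (2014), Thm. 5.7, Prop. 4.10, Def. 3.11, Rem. 5.11,
§4 Notation; the GEN-0/GEN-5 tree files named above. [cite: Spiess2014Invent, Thm. 5.7]
[cite: GreenbergLNM1716, §4 pp. 112–113] [cite: MazurTateTeitelbaum1986Invent, §I.14 and §II.10]
-/

set_option linter.dupNamespace false
set_option autoImplicit false

noncomputable section

open scoped Classical MatrixGroups ModularForm

open CongruenceSubgroup WeierstrassCurve Literature.NumberTheory.EllipticCurves
  Literature.NumberTheory.EllipticCurves.ModularForms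
  Literature.NumberTheory.EllipticCurves.Greenberg1999
  Literature.NumberTheory.EllipticCurves.Rank1Residual
  Literature.NumberTheory.EllipticCurves.Rank1Residual.Typed
  Literature.NumberTheory.EllipticCurves.Spiess2014
  Summit.BirchSwinnertonDyer.Rank1Residual.X5
  Summit.BirchSwinnertonDyer.Rank1Residual.X5.O1
  Summit.BirchSwinnertonDyer.BirchSwinnertonDyer.Theses.TwoAdicConverse

namespace Summit.BirchSwinnertonDyer.BirchSwinnertonDyer.Theorems

namespace MultSplitWeakEZ

/-! ## §1 The per-curve split door with the PRINT binder -/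

section PerCurve

variable (W : WeierstrassCurve ℚ) [W.IsElliptic] [W.IsGloballyMinimal]

/-- **Rank-`0` `2`-converse at a SPLIT multiplicative `2` from T-mult-4-int, keyed to the PRINTED weak
exceptional-zero vanishing (Spieß 2014 Thm. 5.7) instead of the Greenberg–Stevens identity.** Inputs:
Greenberg's split display at `2` (`h41`, A236, PRINT), modularity (with the rational `ϖ`), Mahler–Manin
(`𝓛₂(E) ≠ 0`, inside), «`X` torsion» (`hX`, K11b), T-mult-4-int (`hEis`), and
`hW : Spiess2014.thm57_weakExceptionalZero_splitMultiplicative_rat W 2` (`[0]⁺_f = 0 ⇒ [T¹]L₂ = 0`, PRINT, any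
`p`). If `Sel_{2^∞}(E/ℚ)` is finite then `L(E,1) ≠ 0` and `r_an(E) = 0`: A236 gives `f_X(0) ≠ 0`; T-mult-4-int
(coefficient of `T¹`, `L₂(0) = 0`) gives `f_X(0) = h(0)·ϖ·[T¹]L₂`, so `[T¹]L₂ ≠ 0`, and `hW` (contrapositive)
gives `[0]⁺_f ≠ 0`. Proof = `analyticRank_eq_zero_of_finite_selmer_split_two_of_multEisenstein` (seat
bsd-2adic-conv-2 GEN 0) verbatim except the last step. [cite: Spiess2014Invent, Thm. 5.7]
[cite: GreenbergLNM1716, §4 pp. 112–113] [cite: MazurTateTeitelbaum1986Invent, §II.10] -/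
theorem analyticRank_eq_zero_of_finite_selmer_split_two_of_multEisenstein_of_weakEZ
    (hW : thm57_weakExceptionalZero_splitMultiplicative_rat W 2)
    (h41 : thm41Analogue_charValue_rankZero_split_baseChange_anyPrime)
    (hmod : nonempty_modularParametrizationData)
    (hX : ∀ (κ : ZpExtension ℚ 2) (γ : Field.absoluteGaloisGroup ℚ), κ.IsCyclotomic →
      κ.IsTopGenerator γ → IsCyclotomicVariable 2 γ → ∀ D : W.SelmerDualData κ γ, D.IsTorsion)
    (hEis : MultEisensteinDivisibilityAtTwo W)
    (hmult : Mult W 2) (hsp : W.HasSplitMultiplicativeReductionAtPrime 2)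
    (hfin : Finite (W.selmerGroupPInfty 2)) :
    W.entireLFunction 1 ≠ 0 ∧ W.analyticRank = 0 := by
  haveI : NeZero (W.conductorNorm ℤ) := ⟨(W.conductorNorm_pos_holds).ne'⟩
  obtain ⟨Dm⟩ := hmod W
  have hf : IsNewformOf W Dm.f := Dm.isNewformOf
  obtain ⟨ϖ, hϖpos, hϖ, -⟩ := Dm.exists_rat_mul_realPeriodRat_eq_plusPeriod
  obtain ⟨κ, hκ, γ, hγ, hγ'⟩ := exists_isCyclotomic_isTopGenerator_isCyclotomicVariable_holds 2
  obtain ⟨D⟩ := W.nonempty_selmerDualData_holds κ γ hγ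
  obtain ⟨L, hL⟩ := exists_isSplitMultPAdicLFunctionOf hsp hf
  obtain ⟨Dq⟩ := (nonempty_tateParameterData_iff_holds (W := W) (p := 2)).mpr hsp
  have hlog : padicLog 2 Dq.q ≠ 0 :=
    Dq.padicLog_q_ne_zero Literature.NumberTheory.Transcendental.MahlerManinPadic_holds
  have hXD : D.IsTorsion := hX κ γ hκ hγ hγ' D
  haveI : Module.Finite (IwasawaAlgebra 2) D.X := D.module_finite_holds hγ
  haveI : (Module.charIdeal (IwasawaAlgebra 2) D.X).IsPrincipal := charIdeal_isPrincipal_holds 2 D.X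
  obtain ⟨fE, hchar⟩ := Submodule.IsPrincipal.principal (Module.charIdeal (IwasawaAlgebra 2) D.X)
  have hchar' : D.charIdeal = Ideal.span {fE} := hchar
  -- Greenberg's split display at `2` (A236): `f_E(0) ≠ 0` since `Sel` is finite
  have hEC : TwoAdicEulerCharRankZeroSplitMult W 0 :=
    twoAdicEulerCharRankZeroSplitMult_zero_of_greenberg W h41
  obtain ⟨u, hu⟩ := hEC hmult hsp κ γ hκ hγ hγ' D hXD fE hchar' hfin Dq hlog
  have hcard : (Nat.card (W.selmerGroupPInfty 2) : ℚ_[2]) ≠ 0 := by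
    haveI := hfin
    exact_mod_cast (Nat.card_pos (α := W.selmerGroupPInfty 2)).ne'
  have hLI0 : LInvariant Dq ≠ 0 := lInvariant_two_ne_zero W Dq
  have hfE0 : ((PowerSeries.constantCoeff fE : ℤ_[2]) : ℚ_[2]) ≠ 0 := by
    intro h0
    rw [h0, zero_mul] at hu
    refine (mul_ne_zero (mul_ne_zero (mul_ne_zero (coe_units_ne_zero 2 u) ?_)
      (zpow_ne_zero _ two_ne_zero)) hcard) hu.symm
    exact div_ne_zero hLI0 (by norm_num)
  -- T-mult-4-int, split clause at `(Dm.f, ϖ)`: `ι(T · f_E) = ι h · (ϖ · L)`; coefficient of `T¹`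
  obtain ⟨-, hsp'⟩ := hEis κ γ hκ hγ hγ' hmult Dm.f hf ϖ hϖ D fE hchar'
  obtain ⟨h, hdiv⟩ := hsp' hsp L hL
  have h1 := congrArg (PowerSeries.coeff 1) hdiv
  rw [coeff_one_iwasawaToPowerSeries_X_mul, ← mul_assoc, PowerSeries.coeff_mul,
    Finset.Nat.sum_antidiagonal_eq_sum_range_succ_mk, Finset.sum_range_succ,
    Finset.sum_range_succ, Finset.sum_range_zero, zero_add,
    PowerSeries.coeff_zero_eq_constantCoeff_apply L, hL.constantCoeff_eq_zero, mul_zero, add_zero,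
    PowerSeries.coeff_zero_eq_constantCoeff_apply, map_mul, PowerSeries.constantCoeff_C,
    constantCoeff_iwasawaToPowerSeries] at h1
  -- `f_E(0) = h(0) · ϖ · [T¹]L`, so `[T¹]L ≠ 0`
  have hc1 : PowerSeries.coeff 1 L ≠ 0 := by
    intro hz
    rw [hz, mul_zero] at h1
    exact hfE0 h1
  -- Spieß Thm. 5.7 at `(W, 2)` (weak exceptional zero, contrapositive): `[T¹]L ≠ 0 ⇒ [0]⁺_f ≠ 0`
  have hs0' : ratPlusSymbol Dm.f 0 ≠ 0 := hW.ratPlusSymbol_zero_ne_zero Dq hf hL hc1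
  have hL1 : W.entireLFunction 1 ≠ 0 := (ratPlusSymbol_zero_ne_zero_iff W hf).mp hs0'
  exact ⟨hL1, (W.analyticRank_eq_zero_iff_holds hf.hasEntireLFunction).mpr hL1⟩

end PerCurve

/-! ## §2 The WALL chain with the PRINT binder (no memo binder left on the S3 side) -/

/-- **SPLIT half of the crux from WALL-S3-sp + PRINT only.** PRINT {A236 `h41sp`, modularity `hmod`, Greenberg
Thm. 1.5 `h15`, Spieß Thm. 5.7 at every split-at-`2` curve `hW`} and WALL-S3-sp (`hWsp`) ⟹ for every non-CM `W`
SPLIT multiplicative at `2`: `corank Sel_{2^∞} = 0 ⇒ r_an(W) = 0`. Same transport up to isogeny as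
`MultWalls.splitMultRankZeroTwoConverse_of_wallS3`, with §1 at `W'`.
[cite: Spiess2014Invent, Thm. 5.7] [cite: GreenbergLNM1716, §4 pp. 112–113 and Thm. 1.5 (p. 61)] -/
theorem splitMultRankZeroTwoConverse_of_wallS3_of_weakEZ
    (h41sp : thm41Analogue_charValue_rankZero_split_baseChange_anyPrime)
    (hmod : nonempty_modularParametrizationData) (h15 : thm15_isTorsion_multiplicative_rat)
    (hW : ∀ (W : WeierstrassCurve ℚ) [W.IsElliptic] [W.IsGloballyMinimal],
      W.HasSplitMultiplicativeReductionAtPrime 2 → thm57_weakExceptionalZero_splitMultiplicative_rat W 2)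
    (hWsp : ∀ (W : WeierstrassCurve ℚ) [W.IsElliptic] [W.IsGloballyMinimal], ¬ W.HasCM → Mult W 2 →
      W.HasSplitMultiplicativeReductionAtPrime 2 → W.selmerCorank 2 = 0 →
        ∃ (W' : WeierstrassCurve ℚ) (_ : W'.IsElliptic) (_ : W'.IsGloballyMinimal),
          IsIsogenous W W' ∧ Mult W' 2 ∧ MultEisensteinDivisibilityAtTwo W') :
    ∀ (W : WeierstrassCurve ℚ) [W.IsElliptic] [W.IsGloballyMinimal], ¬ W.HasCM → Mult W 2 →
      W.HasSplitMultiplicativeReductionAtPrime 2 → W.selmerCorank 2 = 0 → W.analyticRank = 0 := by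
  intro W _ _ hcm hmult hsp hsel
  obtain ⟨W', _, _, hiso, hmult', hE'⟩ := hWsp W hcm hmult hsp hsel
  refine analyticRank_eq_zero_of_isIsogenous_of_selmerCorank_two_eq_zero hiso (fun hsel' ↦ ?_) hsel
  have hsp' : W'.HasSplitMultiplicativeReductionAtPrime 2 :=
    (hasSplitMultiplicativeReductionAtPrime_two_iff_of_isIsogenous hiso).mp hsp
  have hfin' : Finite (W'.selmerGroupPInfty 2) :=
    (finite_selmerGroupPInfty_iff_selmerCorank_eq_zero W' 2).mpr hsel'
  exact (analyticRank_eq_zero_of_finite_selmer_split_two_of_multEisenstein_of_weakEZ W' (hW W' hsp') h41sp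
    hmod (isTorsion_two_of_thm15 W' h15 hmod hmult') hE' hmult' hsp' hfin').2

/-- **The crux `MultiplicativeRankZeroTwoConverse` (item 19219) from the two S3ᵐ walls + PRINT only** (no memo
binder): PRINT {A235-twin, A236, modularity, Greenberg Thm. 1.5, Spieß Thm. 5.7 at split-at-`2` curves} +
WALL-S3-ns + WALL-S3-sp ⟹ 19219, by `multiplicativeRankZeroTwoConverse_iff_bySign`.
[cite: Spiess2014Invent, Thm. 5.7] [cite: GreenbergLNM1716, §4 pp. 112–113 and Thm. 1.5 (p. 61)] -/
theorem multiplicativeRankZeroTwoConverse_of_wallsS3_of_weakEZ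
    (h41ns : thm41Analogue_charValue_rankZero_numberField_anyPrime_oddLocalDegree)
    (h41sp : thm41Analogue_charValue_rankZero_split_baseChange_anyPrime)
    (hmod : nonempty_modularParametrizationData) (h15 : thm15_isTorsion_multiplicative_rat)
    (hW : ∀ (W : WeierstrassCurve ℚ) [W.IsElliptic] [W.IsGloballyMinimal],
      W.HasSplitMultiplicativeReductionAtPrime 2 → thm57_weakExceptionalZero_splitMultiplicative_rat W 2)
    (hWns : ∀ (W : WeierstrassCurve ℚ) [W.IsElliptic] [W.IsGloballyMinimal], ¬ W.HasCM → Mult W 2 →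
      ¬ W.HasSplitMultiplicativeReductionAtPrime 2 → W.selmerCorank 2 = 0 →
        ∃ (W' : WeierstrassCurve ℚ) (_ : W'.IsElliptic) (_ : W'.IsGloballyMinimal),
          IsIsogenous W W' ∧ Mult W' 2 ∧ MultEisensteinDivisibilityAtTwo W')
    (hWsp : ∀ (W : WeierstrassCurve ℚ) [W.IsElliptic] [W.IsGloballyMinimal], ¬ W.HasCM → Mult W 2 →
      W.HasSplitMultiplicativeReductionAtPrime 2 → W.selmerCorank 2 = 0 →
        ∃ (W' : WeierstrassCurve ℚ) (_ : W'.IsElliptic) (_ : W'.IsGloballyMinimal),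
          IsIsogenous W W' ∧ Mult W' 2 ∧ MultEisensteinDivisibilityAtTwo W') :
    MultiplicativeRankZeroTwoConverse :=
  multiplicativeRankZeroTwoConverse_iff_bySign.mpr
    ⟨MultWalls.nonsplitMultRankZeroTwoConverse_of_wallS3 h41ns hmod h15 hWns,
      splitMultRankZeroTwoConverse_of_wallS3_of_weakEZ h41sp hmod h15 hW hWsp⟩

/-- **The SERVED crux `MultTwoConverseOverKAtTwo` (item 19187) from the two S3ᵐ walls + PRINT only**: the
route's PUB child `MultConversePublishedInputsAtTwo` (`hP`, item 19185) + PRINT {A235-twin, A236, modularity,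
Thm. 1.5, Spieß Thm. 5.7} + WALL-S3-ns + WALL-S3-sp ⟹ 19187, through `19219 ⟹ 19187` modulo PUB
(`multTwoConverseOverKAtTwo_of_multiplicativeRankZeroTwoConverse`, p418586). This is the composition of LINE
`cycint` v2 with `stub_gs2` (MEMO) replaced by the PRINT stub `hW`.
[cite: Spiess2014Invent, Thm. 5.7] [cite: Kato2004Asterisque, Cor. 14.3 (p. 235)] -/
theorem multTwoConverseOverKAtTwo_of_wallsS3_of_weakEZ (hP : MultConversePublishedInputsAtTwo)
    (h41ns : thm41Analogue_charValue_rankZero_numberField_anyPrime_oddLocalDegree)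
    (h41sp : thm41Analogue_charValue_rankZero_split_baseChange_anyPrime)
    (hmod : nonempty_modularParametrizationData) (h15 : thm15_isTorsion_multiplicative_rat)
    (hW : ∀ (W : WeierstrassCurve ℚ) [W.IsElliptic] [W.IsGloballyMinimal],
      W.HasSplitMultiplicativeReductionAtPrime 2 → thm57_weakExceptionalZero_splitMultiplicative_rat W 2)
    (hWns : ∀ (W : WeierstrassCurve ℚ) [W.IsElliptic] [W.IsGloballyMinimal], ¬ W.HasCM → Mult W 2 →
      ¬ W.HasSplitMultiplicativeReductionAtPrime 2 → W.selmerCorank 2 = 0 →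
        ∃ (W' : WeierstrassCurve ℚ) (_ : W'.IsElliptic) (_ : W'.IsGloballyMinimal),
          IsIsogenous W W' ∧ Mult W' 2 ∧ MultEisensteinDivisibilityAtTwo W')
    (hWsp : ∀ (W : WeierstrassCurve ℚ) [W.IsElliptic] [W.IsGloballyMinimal], ¬ W.HasCM → Mult W 2 →
      W.HasSplitMultiplicativeReductionAtPrime 2 → W.selmerCorank 2 = 0 →
        ∃ (W' : WeierstrassCurve ℚ) (_ : W'.IsElliptic) (_ : W'.IsGloballyMinimal),
          IsIsogenous W W' ∧ Mult W' 2 ∧ MultEisensteinDivisibilityAtTwo W') :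
    MultTwoConverseOverKAtTwo :=
  multTwoConverseOverKAtTwo_of_multiplicativeRankZeroTwoConverse hP
    (multiplicativeRankZeroTwoConverse_of_wallsS3_of_weakEZ h41ns h41sp hmod h15 hW hWns hWsp)

/-! ## §3 Bookkeeping: the old MEMO binder implies the new PRINT binder -/

/-- The family-wide Greenberg–Stevens binder of the existing doors implies the family-wide weak binder used
here (`Spiess2014.…_of_greenberg_stevens`), so every composition keyed to `hGS` re-keys to `hW` in one line and
nothing proved before is lost. [cite: Spiess2014Invent, Thm. 5.7 (comparison with the strong form)] -/
theorem weakEZ_two_of_greenbergStevens_two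
    (hGS : ∀ (W : WeierstrassCurve ℚ) [W.IsElliptic] [W.IsGloballyMinimal],
      W.HasSplitMultiplicativeReductionAtPrime 2 → greenberg_stevens (W := W) (p := 2)) :
    ∀ (W : WeierstrassCurve ℚ) [W.IsElliptic] [W.IsGloballyMinimal],
      W.HasSplitMultiplicativeReductionAtPrime 2 → thm57_weakExceptionalZero_splitMultiplicative_rat W 2 :=
  fun W _ _ hsp ↦ thm57_weakExceptionalZero_splitMultiplicative_rat_of_greenberg_stevens (hGS W hsp)

end MultSplitWeakEZ

end Summit.BirchSwinnertonDyer.BirchSwinnertonDyer.Theorems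

end
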